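import Summits.QuantumFields.YangMills.Theorems.FemtoCurvatureTwoPoint.Negative.FiniteGroupPeierls

/-!
# `FemtoCurvatureTwoPoint` — vortices through the reference plaquettes of `(ℤ/8)⁴`
# (support file for `Negative.FiniteGroupFalse`)

Negative-side support for crux `Summit.QuantumFields.YangMills.Theses.LangevinControlUV.
FemtoCurvatureTwoPoint` (item stmt-QuantumFields-9363; cdisprove gen 1), sequel of
`Negative.FiniteGroupPeierls`. For a closed plaquette configuration `η` of a finite abelian group
on the torus `(ℤ/8)⁴` (a vortex configuration):

* `five_le_card_rcomponent_p0`, `…_p1`, `…_q0` — the cube-connected component of the support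
  through `p₀ = (0; 0,1)` (resp. `p₁ = (e₂; 0,1)`, `q₀ = (0; 0,2)`) has at least `5` plaquettes:
  each of the four `3`-cells containing the plaquette carries another support plaquette, in four
  pairwise disjoint face sets;
* `eight_le_card_rcomponent_p0p1` — a component containing BOTH `p₀` and `p₁` has at least `8`
  plaquettes (three cells through `p₀` avoiding `p₁`, three through `p₁` avoiding `p₀`).

All distinctness facts are decided on the explicit torus `(ℤ/8)⁴`.
-/

noncomputable section

open Finset Function
open Literature.MathematicalPhysics.QuantumFieldTheory
open Literature.MathematicalPhysics.QuantumFieldTheory.LatticeForm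
open Literature.Probability.LatticeModels (IsRConnected rcomponent rcomponents mem_rcomponent
  rcomponent_subset mem_rcomponent_self rcomponent_eq_of_mem isRConnected_rcomponent
  mem_rcomponents_iff)
open Summit.QuantumFields.YangMills.Theorems.FemtoCurvatureTwoPoint.Negative.FiniteGroupPeierls

namespace Summit.QuantumFields.YangMills.Theorems.FemtoCurvatureTwoPoint.Negative.FiniteGroupVortices

/- At the concrete torus `L = 8` the unifier must never unfold the vortex-gas finsets
(`Finset.univ.filter …` over all configurations): made irreducible for this file. -/
attribute [local irreducible] psupp Closed Fib connSets

/-- The plane `(0,1)` is genuine: `0 < 1` in `Fin 4` (fixed proof term for the plaquette data). -/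
theorem h01 : (0 : Fin 4) < 1 := by decide
/-- The plane `(0,2)` is genuine. -/
theorem h02 : (0 : Fin 4) < 2 := by decide
/-- The plane `(0,3)` is genuine. -/
theorem h03 : (0 : Fin 4) < 3 := by decide
/-- The plane `(1,2)` is genuine. -/
theorem h12 : (1 : Fin 4) < 2 := by decide
/-- The plane `(1,3)` is genuine. -/
theorem h13 : (1 : Fin 4) < 3 := by decide
/-- The plane `(2,3)` is genuine. -/
theorem h23 : (2 : Fin 4) < 3 := by decide

variable {A : Type*} [AddCommGroup A] [DecidableEq A]

/-- A support plaquette cube-adjacent to the support plaquette `p` lies in the component of `p`. -/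
theorem mem_rcomponent_of_cubeAdj {d L : ℕ} [NeZero L] {η : Plaquette d L → A}
    {p f : Plaquette d L} (hp : η p ≠ 0) (hf : η f ≠ 0) (hadj : CubeAdj p f) :
    f ∈ rcomponent CubeAdj (psupp η) p :=
  mem_rcomponent.2 ⟨mem_psupp.2 hf,
    Relation.ReflTransGen.single ⟨hadj, mem_psupp.2 hp, mem_psupp.2 hf⟩⟩

/-- **A vortex through `p₀ = (0; 0,1)` has at least `5` plaquettes** (one more face on each of the
four `3`-cells containing `p₀`, in pairwise disjoint face sets of `(ℤ/8)⁴`). -/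
theorem five_le_card_rcomponent_p0 {η : Plaquette 4 8 → A} (hη : IsClosedPl η)
    (h0 : η ((0 : Site 4 8), ⟨(0, 1), h01⟩) ≠ 0) :
    5 ≤ (rcomponent CubeAdj (psupp η) ((0 : Site 4 8), ⟨(0, 1), h01⟩)).card := by
  have c1 := ne_zero_face₅ hη (0 : Site 4 8) h01 h12 h0
  have h0' : η ((-te 2 : Site 4 8) + te 2, ⟨(0, 1), h01⟩) ≠ 0 := by rwa [neg_add_cancel]
  have c2 := ne_zero_face₆ hη (-te 2 : Site 4 8) h01 h12 h0'
  have c3 := ne_zero_face₅ hη (0 : Site 4 8) h01 h13 h0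
  have h0'' : η ((-te 3 : Site 4 8) + te 3, ⟨(0, 1), h01⟩) ≠ 0 := by rwa [neg_add_cancel]
  have c4 := ne_zero_face₆ hη (-te 3 : Site 4 8) h01 h13 h0''
  have adj : ∀ {f : Plaquette 4 8} (x : Site 4 8) {i j k : Fin 4} (hij : i < j) (hjk : j < k),
      ((0 : Site 4 8), ⟨(0, 1), h01⟩) ∈ cubeFaces x hij hjk → f ∈ cubeFaces x hij hjk → η f ≠ 0 →
        f ∈ rcomponent CubeAdj (psupp η) ((0 : Site 4 8), ⟨(0, 1), h01⟩) :=
    fun x i j k hij hjk hp hf hne => mem_rcomponent_of_cubeAdj h0 hne ⟨x, _, _, _, hij, hjk, hp, hf⟩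
  refine le_card_of_meets_disjoint_list
    [({((0 : Site 4 8), ⟨(0, 1), h01⟩)} : Finset (Plaquette 4 8)),
      {((0 : Site 4 8), ⟨(1, 2), h12⟩), ((0 : Site 4 8) + te 0, ⟨(1, 2), h12⟩),
        ((0 : Site 4 8), ⟨(0, 2), h02⟩), ((0 : Site 4 8) + te 1, ⟨(0, 2), h02⟩),
        ((0 : Site 4 8) + te 2, ⟨(0, 1), h01⟩)},
      {((-te 2 : Site 4 8), ⟨(1, 2), h12⟩), ((-te 2 : Site 4 8) + te 0, ⟨(1, 2), h12⟩),
        ((-te 2 : Site 4 8), ⟨(0, 2), h02⟩), ((-te 2 : Site 4 8) + te 1, ⟨(0, 2), h02⟩),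
        ((-te 2 : Site 4 8), ⟨(0, 1), h01⟩)},
      {((0 : Site 4 8), ⟨(1, 3), h13⟩), ((0 : Site 4 8) + te 0, ⟨(1, 3), h13⟩),
        ((0 : Site 4 8), ⟨(0, 3), h03⟩), ((0 : Site 4 8) + te 1, ⟨(0, 3), h03⟩),
        ((0 : Site 4 8) + te 3, ⟨(0, 1), h01⟩)},
      {((-te 3 : Site 4 8), ⟨(1, 3), h13⟩), ((-te 3 : Site 4 8) + te 0, ⟨(1, 3), h13⟩),
        ((-te 3 : Site 4 8), ⟨(0, 3), h03⟩), ((-te 3 : Site 4 8) + te 1, ⟨(0, 3), h03⟩),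
        ((-te 3 : Site 4 8), ⟨(0, 1), h01⟩)}]
    (rcomponent CubeAdj (psupp η) ((0 : Site 4 8), ⟨(0, 1), h01⟩)) ?_ ?_
  · refine List.Pairwise.cons ?_ (List.Pairwise.cons ?_ (List.Pairwise.cons ?_
      (List.Pairwise.cons ?_ (List.pairwise_singleton _ _))))
    all_goals intro t ht; simp only [List.mem_cons, List.not_mem_nil, or_false] at ht
    · rcases ht with rfl | rfl | rfl | rfl <;> decide
    · rcases ht with rfl | rfl | rfl <;> decide
    · rcases ht with rfl | rfl <;> decide
    · rcases ht with rfl; decide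
  · intro R hR
    simp only [List.mem_cons, List.not_mem_nil, or_false] at hR
    rcases hR with rfl | rfl | rfl | rfl | rfl
    · exact ⟨_, Finset.mem_singleton_self _, mem_rcomponent_self (mem_psupp.2 h0)⟩
    · rcases c1 with h | h | h | h | h <;>
        exact ⟨_, by decide, adj 0 h01 h12 (by decide) (by decide) h⟩
    · rcases c2 with h | h | h | h | h <;>
        exact ⟨_, by decide, adj (-te 2) h01 h12 (by decide) (by decide) h⟩
    · rcases c3 with h | h | h | h | h <;>
        exact ⟨_, by decide, adj 0 h01 h13 (by decide) (by decide) h⟩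
    · rcases c4 with h | h | h | h | h <;>
        exact ⟨_, by decide, adj (-te 3) h01 h13 (by decide) (by decide) h⟩


/-- **A vortex through `p₁ = (e₂; 0,1)` has at least `5` plaquettes.** -/
theorem five_le_card_rcomponent_p1 {η : Plaquette 4 8 → A} (hη : IsClosedPl η)
    (h1 : η ((te 2 : Site 4 8), ⟨(0, 1), h01⟩) ≠ 0) :
    5 ≤ (rcomponent CubeAdj (psupp η) ((te 2 : Site 4 8), ⟨(0, 1), h01⟩)).card := by
  have c1 := ne_zero_face₅ hη (te 2 : Site 4 8) h01 h12 h1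
  have h1' : η ((0 : Site 4 8) + te 2, ⟨(0, 1), h01⟩) ≠ 0 := by rwa [zero_add]
  have c2 := ne_zero_face₆ hη (0 : Site 4 8) h01 h12 h1'
  have c3 := ne_zero_face₅ hη (te 2 : Site 4 8) h01 h13 h1
  have h1'' : η ((te 2 - te 3 : Site 4 8) + te 3, ⟨(0, 1), h01⟩) ≠ 0 := by rwa [sub_add_cancel]
  have c4 := ne_zero_face₆ hη (te 2 - te 3 : Site 4 8) h01 h13 h1''
  have adj : ∀ {f : Plaquette 4 8} (x : Site 4 8) {i j k : Fin 4} (hij : i < j) (hjk : j < k),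
      ((te 2 : Site 4 8), ⟨(0, 1), h01⟩) ∈ cubeFaces x hij hjk → f ∈ cubeFaces x hij hjk →
        η f ≠ 0 → f ∈ rcomponent CubeAdj (psupp η) ((te 2 : Site 4 8), ⟨(0, 1), h01⟩) :=
    fun x i j k hij hjk hp hf hne => mem_rcomponent_of_cubeAdj h1 hne ⟨x, _, _, _, hij, hjk, hp, hf⟩
  refine le_card_of_meets_disjoint_list
    [({((te 2 : Site 4 8), ⟨(0, 1), h01⟩)} : Finset (Plaquette 4 8)),
      {((te 2 : Site 4 8), ⟨(1, 2), h12⟩), ((te 2 : Site 4 8) + te 0, ⟨(1, 2), h12⟩),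
        ((te 2 : Site 4 8), ⟨(0, 2), h02⟩), ((te 2 : Site 4 8) + te 1, ⟨(0, 2), h02⟩),
        ((te 2 : Site 4 8) + te 2, ⟨(0, 1), h01⟩)},
      {((0 : Site 4 8), ⟨(1, 2), h12⟩), ((0 : Site 4 8) + te 0, ⟨(1, 2), h12⟩),
        ((0 : Site 4 8), ⟨(0, 2), h02⟩), ((0 : Site 4 8) + te 1, ⟨(0, 2), h02⟩),
        ((0 : Site 4 8), ⟨(0, 1), h01⟩)},
      {((te 2 : Site 4 8), ⟨(1, 3), h13⟩), ((te 2 : Site 4 8) + te 0, ⟨(1, 3), h13⟩),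
        ((te 2 : Site 4 8), ⟨(0, 3), h03⟩), ((te 2 : Site 4 8) + te 1, ⟨(0, 3), h03⟩),
        ((te 2 : Site 4 8) + te 3, ⟨(0, 1), h01⟩)},
      {((te 2 - te 3 : Site 4 8), ⟨(1, 3), h13⟩), ((te 2 - te 3 : Site 4 8) + te 0, ⟨(1, 3), h13⟩),
        ((te 2 - te 3 : Site 4 8), ⟨(0, 3), h03⟩), ((te 2 - te 3 : Site 4 8) + te 1, ⟨(0, 3), h03⟩),
        ((te 2 - te 3 : Site 4 8), ⟨(0, 1), h01⟩)}]
    (rcomponent CubeAdj (psupp η) ((te 2 : Site 4 8), ⟨(0, 1), h01⟩)) ?_ ?_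
  · refine List.Pairwise.cons ?_ (List.Pairwise.cons ?_ (List.Pairwise.cons ?_
      (List.Pairwise.cons ?_ (List.pairwise_singleton _ _))))
    all_goals intro t ht; simp only [List.mem_cons, List.not_mem_nil, or_false] at ht
    · rcases ht with rfl | rfl | rfl | rfl <;> decide
    · rcases ht with rfl | rfl | rfl <;> decide
    · rcases ht with rfl | rfl <;> decide
    · rcases ht with rfl; decide
  · intro R hR
    simp only [List.mem_cons, List.not_mem_nil, or_false] at hR
    rcases hR with rfl | rfl | rfl | rfl | rfl
    · exact ⟨_, Finset.mem_singleton_self _, mem_rcomponent_self (mem_psupp.2 h1)⟩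
    · rcases c1 with h | h | h | h | h <;>
        exact ⟨_, by decide, adj (te 2) h01 h12 (by decide) (by decide) h⟩
    · rcases c2 with h | h | h | h | h <;>
        exact ⟨_, by decide, adj 0 h01 h12 (by decide) (by decide) h⟩
    · rcases c3 with h | h | h | h | h <;>
        exact ⟨_, by decide, adj (te 2) h01 h13 (by decide) (by decide) h⟩
    · rcases c4 with h | h | h | h | h <;>
        exact ⟨_, by decide, adj (te 2 - te 3) h01 h13 (by decide) (by decide) h⟩

/-- **A vortex through `q₀ = (0; 0,2)` has at least `5` plaquettes.** -/
theorem five_le_card_rcomponent_q0 {η : Plaquette 4 8 → A} (hη : IsClosedPl η)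
    (hq : η ((0 : Site 4 8), ⟨(0, 2), h02⟩) ≠ 0) :
    5 ≤ (rcomponent CubeAdj (psupp η) ((0 : Site 4 8), ⟨(0, 2), h02⟩)).card := by
  have c1 := ne_zero_face₃ hη (0 : Site 4 8) h01 h12 hq
  have hq' : η ((-te 1 : Site 4 8) + te 1, ⟨(0, 2), h01.trans h12⟩) ≠ 0 := by rwa [neg_add_cancel]
  have c2 := ne_zero_face₄ hη (-te 1 : Site 4 8) h01 h12 hq'
  have c3 := ne_zero_face₅ hη (0 : Site 4 8) h02 h23 hq
  have hq'' : η ((-te 3 : Site 4 8) + te 3, ⟨(0, 2), h02⟩) ≠ 0 := by rwa [neg_add_cancel]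
  have c4 := ne_zero_face₆ hη (-te 3 : Site 4 8) h02 h23 hq''
  have adj : ∀ {f : Plaquette 4 8} (x : Site 4 8) {i j k : Fin 4} (hij : i < j) (hjk : j < k),
      ((0 : Site 4 8), ⟨(0, 2), h02⟩) ∈ cubeFaces x hij hjk → f ∈ cubeFaces x hij hjk → η f ≠ 0 →
        f ∈ rcomponent CubeAdj (psupp η) ((0 : Site 4 8), ⟨(0, 2), h02⟩) :=
    fun x i j k hij hjk hp hf hne => mem_rcomponent_of_cubeAdj hq hne ⟨x, _, _, _, hij, hjk, hp, hf⟩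
  refine le_card_of_meets_disjoint_list
    [({((0 : Site 4 8), ⟨(0, 2), h02⟩)} : Finset (Plaquette 4 8)),
      {((0 : Site 4 8), ⟨(1, 2), h12⟩), ((0 : Site 4 8) + te 0, ⟨(1, 2), h12⟩),
        ((0 : Site 4 8) + te 1, ⟨(0, 2), h02⟩), ((0 : Site 4 8), ⟨(0, 1), h01⟩),
        ((0 : Site 4 8) + te 2, ⟨(0, 1), h01⟩)},
      {((-te 1 : Site 4 8), ⟨(1, 2), h12⟩), ((-te 1 : Site 4 8) + te 0, ⟨(1, 2), h12⟩),
        ((-te 1 : Site 4 8), ⟨(0, 2), h02⟩), ((-te 1 : Site 4 8), ⟨(0, 1), h01⟩),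
        ((-te 1 : Site 4 8) + te 2, ⟨(0, 1), h01⟩)},
      {((0 : Site 4 8), ⟨(2, 3), h23⟩), ((0 : Site 4 8) + te 0, ⟨(2, 3), h23⟩),
        ((0 : Site 4 8), ⟨(0, 3), h03⟩), ((0 : Site 4 8) + te 2, ⟨(0, 3), h03⟩),
        ((0 : Site 4 8) + te 3, ⟨(0, 2), h02⟩)},
      {((-te 3 : Site 4 8), ⟨(2, 3), h23⟩), ((-te 3 : Site 4 8) + te 0, ⟨(2, 3), h23⟩),
        ((-te 3 : Site 4 8), ⟨(0, 3), h03⟩), ((-te 3 : Site 4 8) + te 2, ⟨(0, 3), h03⟩),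
        ((-te 3 : Site 4 8), ⟨(0, 2), h02⟩)}]
    (rcomponent CubeAdj (psupp η) ((0 : Site 4 8), ⟨(0, 2), h02⟩)) ?_ ?_
  · refine List.Pairwise.cons ?_ (List.Pairwise.cons ?_ (List.Pairwise.cons ?_
      (List.Pairwise.cons ?_ (List.pairwise_singleton _ _))))
    all_goals intro t ht; simp only [List.mem_cons, List.not_mem_nil, or_false] at ht
    · rcases ht with rfl | rfl | rfl | rfl <;> decide
    · rcases ht with rfl | rfl | rfl <;> decide
    · rcases ht with rfl | rfl <;> decide
    · rcases ht with rfl; decide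
  · intro R hR
    simp only [List.mem_cons, List.not_mem_nil, or_false] at hR
    rcases hR with rfl | rfl | rfl | rfl | rfl
    · exact ⟨_, Finset.mem_singleton_self _, mem_rcomponent_self (mem_psupp.2 hq)⟩
    · rcases c1 with h | h | h | h | h <;>
        exact ⟨_, by decide, adj 0 h01 h12 (by decide) (by decide) h⟩
    · rcases c2 with h | h | h | h | h <;>
        exact ⟨_, by decide, adj (-te 1) h01 h12 (by decide) (by decide) h⟩
    · rcases c3 with h | h | h | h | h <;>
        exact ⟨_, by decide, adj 0 h02 h23 (by decide) (by decide) h⟩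
    · rcases c4 with h | h | h | h | h <;>
        exact ⟨_, by decide, adj (-te 3) h02 h23 (by decide) (by decide) h⟩

/-- **A vortex through both `p₀ = (0; 0,1)` and `p₁ = (e₂; 0,1)` has at least `8` plaquettes**: one
more face on each of the three `3`-cells containing `p₀` but not `p₁`, and on each of the three
containing `p₁` but not `p₀` — eight pairwise disjoint regions of `(ℤ/8)⁴` each met by the vortex. -/
theorem eight_le_card_rcomponent_p0p1 {η : Plaquette 4 8 → A} (hη : IsClosedPl η)
    (h0 : η ((0 : Site 4 8), ⟨(0, 1), h01⟩) ≠ 0) (h1 : η ((te 2 : Site 4 8), ⟨(0, 1), h01⟩) ≠ 0)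
    (hmem : ((te 2 : Site 4 8), ⟨(0, 1), h01⟩) ∈
      rcomponent CubeAdj (psupp η) ((0 : Site 4 8), ⟨(0, 1), h01⟩)) :
    8 ≤ (rcomponent CubeAdj (psupp η) ((0 : Site 4 8), ⟨(0, 1), h01⟩)).card := by
  have hcomp : rcomponent CubeAdj (psupp η) ((te 2 : Site 4 8), ⟨(0, 1), h01⟩) =
      rcomponent CubeAdj (psupp η) ((0 : Site 4 8), ⟨(0, 1), h01⟩) :=
    rcomponent_eq_of_mem (fun _ _ => cubeAdj_symm) hmem
  have h0' : η ((-te 2 : Site 4 8) + te 2, ⟨(0, 1), h01⟩) ≠ 0 := by rwa [neg_add_cancel]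
  have c2 := ne_zero_face₆ hη (-te 2 : Site 4 8) h01 h12 h0'
  have c3 := ne_zero_face₅ hη (0 : Site 4 8) h01 h13 h0
  have h0'' : η ((-te 3 : Site 4 8) + te 3, ⟨(0, 1), h01⟩) ≠ 0 := by rwa [neg_add_cancel]
  have c4 := ne_zero_face₆ hη (-te 3 : Site 4 8) h01 h13 h0''
  have d1 := ne_zero_face₅ hη (te 2 : Site 4 8) h01 h12 h1
  have d3 := ne_zero_face₅ hη (te 2 : Site 4 8) h01 h13 h1
  have h1'' : η ((te 2 - te 3 : Site 4 8) + te 3, ⟨(0, 1), h01⟩) ≠ 0 := by rwa [sub_add_cancel]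
  have d4 := ne_zero_face₆ hη (te 2 - te 3 : Site 4 8) h01 h13 h1''
  have adj0 : ∀ {f : Plaquette 4 8} (x : Site 4 8) {i j k : Fin 4} (hij : i < j) (hjk : j < k),
      ((0 : Site 4 8), ⟨(0, 1), h01⟩) ∈ cubeFaces x hij hjk → f ∈ cubeFaces x hij hjk → η f ≠ 0 →
        f ∈ rcomponent CubeAdj (psupp η) ((0 : Site 4 8), ⟨(0, 1), h01⟩) :=
    fun x i j k hij hjk hp hf hne => mem_rcomponent_of_cubeAdj h0 hne ⟨x, _, _, _, hij, hjk, hp, hf⟩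
  have adj1 : ∀ {f : Plaquette 4 8} (x : Site 4 8) {i j k : Fin 4} (hij : i < j) (hjk : j < k),
      ((te 2 : Site 4 8), ⟨(0, 1), h01⟩) ∈ cubeFaces x hij hjk → f ∈ cubeFaces x hij hjk →
        η f ≠ 0 → f ∈ rcomponent CubeAdj (psupp η) ((0 : Site 4 8), ⟨(0, 1), h01⟩) :=
    fun x i j k hij hjk hp hf hne =>
      hcomp ▸ mem_rcomponent_of_cubeAdj h1 hne ⟨x, _, _, _, hij, hjk, hp, hf⟩
  refine le_card_of_meets_disjoint_list
    [({((0 : Site 4 8), ⟨(0, 1), h01⟩)} : Finset (Plaquette 4 8)),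
      {((te 2 : Site 4 8), ⟨(0, 1), h01⟩)},
      {((-te 2 : Site 4 8), ⟨(1, 2), h12⟩), ((-te 2 : Site 4 8) + te 0, ⟨(1, 2), h12⟩),
        ((-te 2 : Site 4 8), ⟨(0, 2), h02⟩), ((-te 2 : Site 4 8) + te 1, ⟨(0, 2), h02⟩),
        ((-te 2 : Site 4 8), ⟨(0, 1), h01⟩)},
      {((0 : Site 4 8), ⟨(1, 3), h13⟩), ((0 : Site 4 8) + te 0, ⟨(1, 3), h13⟩),
        ((0 : Site 4 8), ⟨(0, 3), h03⟩), ((0 : Site 4 8) + te 1, ⟨(0, 3), h03⟩),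
        ((0 : Site 4 8) + te 3, ⟨(0, 1), h01⟩)},
      {((-te 3 : Site 4 8), ⟨(1, 3), h13⟩), ((-te 3 : Site 4 8) + te 0, ⟨(1, 3), h13⟩),
        ((-te 3 : Site 4 8), ⟨(0, 3), h03⟩), ((-te 3 : Site 4 8) + te 1, ⟨(0, 3), h03⟩),
        ((-te 3 : Site 4 8), ⟨(0, 1), h01⟩)},
      {((te 2 : Site 4 8), ⟨(1, 2), h12⟩), ((te 2 : Site 4 8) + te 0, ⟨(1, 2), h12⟩),
        ((te 2 : Site 4 8), ⟨(0, 2), h02⟩), ((te 2 : Site 4 8) + te 1, ⟨(0, 2), h02⟩),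
        ((te 2 : Site 4 8) + te 2, ⟨(0, 1), h01⟩)},
      {((te 2 : Site 4 8), ⟨(1, 3), h13⟩), ((te 2 : Site 4 8) + te 0, ⟨(1, 3), h13⟩),
        ((te 2 : Site 4 8), ⟨(0, 3), h03⟩), ((te 2 : Site 4 8) + te 1, ⟨(0, 3), h03⟩),
        ((te 2 : Site 4 8) + te 3, ⟨(0, 1), h01⟩)},
      {((te 2 - te 3 : Site 4 8), ⟨(1, 3), h13⟩), ((te 2 - te 3 : Site 4 8) + te 0, ⟨(1, 3), h13⟩),
        ((te 2 - te 3 : Site 4 8), ⟨(0, 3), h03⟩), ((te 2 - te 3 : Site 4 8) + te 1, ⟨(0, 3), h03⟩),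
        ((te 2 - te 3 : Site 4 8), ⟨(0, 1), h01⟩)}]
    (rcomponent CubeAdj (psupp η) ((0 : Site 4 8), ⟨(0, 1), h01⟩)) ?_ ?_
  · refine List.Pairwise.cons ?_ (List.Pairwise.cons ?_ (List.Pairwise.cons ?_
      (List.Pairwise.cons ?_ (List.Pairwise.cons ?_ (List.Pairwise.cons ?_
        (List.Pairwise.cons ?_ (List.pairwise_singleton _ _)))))))
    all_goals intro t ht; simp only [List.mem_cons, List.not_mem_nil, or_false] at ht
    · rcases ht with rfl | rfl | rfl | rfl | rfl | rfl | rfl <;> decide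
    · rcases ht with rfl | rfl | rfl | rfl | rfl | rfl <;> decide
    · rcases ht with rfl | rfl | rfl | rfl | rfl <;> decide
    · rcases ht with rfl | rfl | rfl | rfl <;> decide
    · rcases ht with rfl | rfl | rfl <;> decide
    · rcases ht with rfl | rfl <;> decide
    · rcases ht with rfl; decide
  · intro R hR
    simp only [List.mem_cons, List.not_mem_nil, or_false] at hR
    rcases hR with rfl | rfl | rfl | rfl | rfl | rfl | rfl | rfl
    · exact ⟨_, Finset.mem_singleton_self _, mem_rcomponent_self (mem_psupp.2 h0)⟩
    · exact ⟨_, Finset.mem_singleton_self _, hmem⟩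
    · rcases c2 with h | h | h | h | h <;>
        exact ⟨_, by decide, adj0 (-te 2) h01 h12 (by decide) (by decide) h⟩
    · rcases c3 with h | h | h | h | h <;>
        exact ⟨_, by decide, adj0 0 h01 h13 (by decide) (by decide) h⟩
    · rcases c4 with h | h | h | h | h <;>
        exact ⟨_, by decide, adj0 (-te 3) h01 h13 (by decide) (by decide) h⟩
    · rcases d1 with h | h | h | h | h <;>
        exact ⟨_, by decide, adj1 (te 2) h01 h12 (by decide) (by decide) h⟩
    · rcases d3 with h | h | h | h | h <;>
        exact ⟨_, by decide, adj1 (te 2) h01 h13 (by decide) (by decide) h⟩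
    · rcases d4 with h | h | h | h | h <;>
        exact ⟨_, by decide, adj1 (te 2 - te 3) h01 h13 (by decide) (by decide) h⟩


end Summit.QuantumFields.YangMills.Theorems.FemtoCurvatureTwoPoint.Negative.FiniteGroupVortices

end
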